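import Mathlib.NumberTheory.LSeries.DirichletContinuation
import Mathlib.NumberTheory.LSeries.RiemannZeta
import Mathlib.Analysis.Calculus.Deriv.Basic
import HarnessLib

/-!
# Subnormal gaps between zeros of `ζ` on the critical line give an effective lower bound
# `L(1, χ) ≫ (log q)^{−90}` (Conrey–Iwaniec 2002, Theorem 1.2) — and its contrapositive, the
# "exceptional character ⇒ almost no close pairs of zeros" rigidity

Topic `Literature/NumberTheory/LFunctions` (namespace `Literature.NumberTheory.LFunctions`).
STATEMENT LAYER for the cell `parity-realchar` (SIEGEL INSTRUMENT, deliverable "illusory-world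
conditionals"; the zero-spacing line "[CI02, Bal16]" of Lu–Zaman–Zhao's list, and the
Conrey–Iwaniec input quoted by Bondarenko–Heap, `SiegelZerosSmallZetaGaps.lean`). ONE named fact
(D-0014) and its proved contrapositive. Nothing here asserts that an exceptional character exists.

## What the source prints (held text `paper:arxiv-math_0111012`, read 2026-08-26)

B. Conrey, H. Iwaniec, *Spacing of zeros of Hecke `L`-functions and the class number problem*,
Acta Arith. 103 (2002) 259–312, §1: "`K = ℚ(√−q)` … the real character `χ` of conductor `q` (the
Kronecker symbol) `χ(n) = (−q/n)` (1.2) … (we assume that `−q` is a fundamental discriminant,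
`q > 4` …)". **Theorem 1.2** (p. 3 of the held copy): "Let `ρ = ½ + iγ` be the zeros of `ζ(s)` on
the critical line and `ρ′ = ½ + iγ′` be the nearest zero to `ρ` on the critical line (`ρ′ = ρ` if
`ρ` is multiple). Suppose
`#{ρ ; 0 < γ ≤ T, |γ − γ′| ≤ (π/log γ)(1 − 1/√log γ)} ≫ T (log T)^{4/5}` (1.22) for any
`T ≥ 2001`. Then we have `L(1,χ) ≫ (log q)^{−90}` (1.23) where the implied constant is effectively
computable." (Bondarenko–Heap 2026, §1, read it contrapositively: "the existence of a Siegel zero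
implies that the number of zeta zeros up to height `T` whose normalised gaps are less than
`1/2 − ε` is `≪ T(log T)^{4/5}`".)

## Lean rendering / design choices

* Zeros of `ζ` ON THE CRITICAL LINE: `riemannZeta (1/2 + γ i) = 0`, `γ : ℝ`; "`ρ′` the nearest
  zero on the line, `ρ′ = ρ` if `ρ` is multiple": the printed condition `|γ − γ′| ≤ r(γ)` for the
  NEAREST `ρ′` is equivalent to the existence of SOME critical zero `γ′ ≠ γ` within `r(γ)`, or
  `ρ` being a multiple zero (`deriv ζ(ρ) = 0`) — this is `HasCloseCriticalNeighbour γ`. The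
  counted objects are the distinct ordinates `γ ∈ (0, T]` (a zero is a point `ρ`); counting
  without multiplicity makes the hypothesis harder to satisfy, hence the rendered theorem is at
  most WEAKER than print. `Set.ncard` of that set (finite, as zeros are isolated; were it infinite
  the junk value `0` again only strengthens the hypothesis).
* "`≫ T(log T)^{4/5}` for any `T ≥ 2001` … then `L(1,χ) ≫ (log q)^{−90}`, implied constant
  effectively computable": `∀ c > 0, ∃ c′ > 0, (∀ T ≥ 2001, count ≥ c T (log T)^{4/5}) → ∀ q χ,
  L(1,χ) ≥ c′ (log q)^{−90}`; effectivity of `c′` in terms of `c` is not expressible and is recorded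
  here only.
* `χ`: the real primitive character of conductor `q` with `−q` a fundamental discriminant,
  `q > 4` ⟺ `χ : DirichletCharacter ℂ q` primitive, quadratic and ODD, `4 < q`. `L(1,χ)` (real,
  positive) as `‖χ.LFunction 1‖`.

PROVED here: the contrapositive `few_close_pairs_of_small_LOne` — for each `c > 0`, with the
constant `c′ = c′(c)` of the theorem, if some real primitive odd `χ` of conductor `q > 4` has
`‖L(1,χ)‖ < c′ (log q)^{−90}`, then the close-pair count falls below `c T (log T)^{4/5}` at some
`T ≥ 2001` — the rigidity quoted by Bondarenko–Heap. Theorem 1.1 (class group `L`-functions of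
`K`, `D(α,T)`) and Corollary 1.3 are not typed. WHAT THIS IS NOT: no claim about the actual
spacing of zeta zeros, nor about the existence of exceptional characters.

## References

* [ConreyIwaniec2002] B. Conrey, H. Iwaniec, Acta Arith. 103 (2002), arXiv:math/0111012, (1.2),
  (1.19), Theorem 1.2 (1.22)–(1.23).
* [BondarenkoHeap2026] §1 (the contrapositive reading; context only).
-/

noncomputable section

namespace Literature.NumberTheory.LFunctions

/-! ### Vocabulary -/

/-- The radius `(π/log γ)(1 − 1/√(log γ))` of (1.22) — just below half the mean spacing
`2π/log γ`. [cite: ConreyIwaniec2002, Theorem 1.2 (1.22)] -/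
def ciRadius (γ : ℝ) : ℝ :=
  Real.pi / Real.log γ * (1 - 1 / Real.sqrt (Real.log γ))

/-- **`ρ = ½ + iγ` is a zero of `ζ` on the critical line whose nearest critical-line zero `ρ′`
lies within `(π/log γ)(1 − 1/√log γ)`** ("`ρ′ = ρ` if `ρ` is multiple"): `ζ(½ + iγ) = 0` and
either `ρ` is a multiple zero or some critical zero `½ + iγ′`, `γ′ ≠ γ`, has `|γ − γ′| ≤ ciRadius γ`.
[cite: ConreyIwaniec2002, Theorem 1.2 (1.22)] -/
def HasCloseCriticalNeighbour (γ : ℝ) : Prop :=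
  riemannZeta (1 / 2 + γ * Complex.I) = 0 ∧
    (deriv riemannZeta (1 / 2 + γ * Complex.I) = 0 ∨
      ∃ γ' : ℝ, γ' ≠ γ ∧ riemannZeta (1 / 2 + γ' * Complex.I) = 0 ∧ |γ - γ'| ≤ ciRadius γ)

/-- The set counted in (1.22): ordinates `0 < γ ≤ T` of critical zeros with a close critical
neighbour. [cite: ConreyIwaniec2002, Theorem 1.2 (1.22)] -/
def closeCriticalZeros (T : ℝ) : Set ℝ :=
  {γ : ℝ | 0 < γ ∧ γ ≤ T ∧ HasCloseCriticalNeighbour γ}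

/-- **Hypothesis (1.22) with implied constant `c`**: `#{ρ ; 0 < γ ≤ T, |γ − γ′| ≤ (π/log γ)(1 − 1/√log γ)} ≥ c T (log T)^{4/5}`
for every `T ≥ 2001` (distinct ordinates counted). A parametrised predicate, never asserted.
[cite: ConreyIwaniec2002, Theorem 1.2 (1.22)] -/
def SubnormalGapsHypothesis (c : ℝ) : Prop :=
  ∀ T : ℝ, 2001 ≤ T → c * T * Real.log T ^ ((4 : ℝ) / 5) ≤ ((closeCriticalZeros T).ncard : ℝ)

/-! ### The named fact -/

/-- **Conrey–Iwaniec 2002, Theorem 1.2.** "Let `ρ = ½ + iγ` be the zeros of `ζ(s)` on the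
critical line and `ρ′ = ½ + iγ′` be the nearest zero to `ρ` on the critical line (`ρ′ = ρ` if `ρ`
is multiple). Suppose `#{ρ ; 0 < γ ≤ T, |γ − γ′| ≤ (π/log γ)(1 − 1/√log γ)} ≫ T(log T)^{4/5}` for
any `T ≥ 2001`. Then we have `L(1,χ) ≫ (log q)^{−90}` where the implied constant is effectively
computable"; `χ = (−q/·)` the real primitive character of conductor `q`, `−q` a fundamental
discriminant, `q > 4`. Rendered: for every `c > 0` there is `c′ > 0` such that
`SubnormalGapsHypothesis c` implies `‖L(1,χ)‖ ≥ c′ (log q)^{−90}` for every primitive quadratic ODD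
`χ` mod `q > 4`. NAMED FACT, not proved here. [cite: ConreyIwaniec2002, Theorem 1.2] -/
def conreyIwaniec2002_theorem12 : Prop :=
  ∀ c : ℝ, 0 < c → ∃ c' : ℝ, 0 < c' ∧
    (SubnormalGapsHypothesis c →
      ∀ (q : ℕ) [NeZero q], 4 < q → ∀ χ : DirichletCharacter ℂ q,
        χ.IsPrimitive → χ.IsQuadratic → χ.Odd →
          c' * Real.log q ^ (-(90 : ℝ)) ≤ ‖χ.LFunction 1‖)

/-! ### Bookkeeping (proved) -/

/-- The hypothesis is antitone in the constant. [cite: ConreyIwaniec2002, Theorem 1.2 (1.22)] -/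
theorem SubnormalGapsHypothesis.anti {c c₀ : ℝ} (hle : c₀ ≤ c) (h : SubnormalGapsHypothesis c) :
    SubnormalGapsHypothesis c₀ := by
  intro T hT
  refine le_trans ?_ (h T hT)
  have hT0 : (0 : ℝ) ≤ T := by linarith
  have hlog : (0 : ℝ) ≤ Real.log T ^ ((4 : ℝ) / 5) := Real.rpow_nonneg (Real.log_nonneg (by linarith)) _
  have := mul_le_mul_of_nonneg_right (mul_le_mul_of_nonneg_right hle hT0) hlog
  exact this

/-- **The contrapositive (Bondarenko–Heap's reading): an exceptional character suppresses close
pairs of critical zeros.** Modulo Theorem 1.2: for every `c > 0`, with its constant `c′ = c′(c)`,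
if SOME primitive quadratic odd character `χ` of conductor `q > 4` has `‖L(1,χ)‖ < c′ (log q)^{−90}`,
then (1.22) fails with constant `c`: for some `T ≥ 2001`, fewer than `c T (log T)^{4/5}` critical
zeros `0 < γ ≤ T` have a critical neighbour within `(π/log γ)(1 − 1/√log γ)`.
[cite: ConreyIwaniec2002, Theorem 1.2] [cite: BondarenkoHeap2026, §1] -/
theorem few_close_pairs_of_small_LOne (hCI : conreyIwaniec2002_theorem12) {c : ℝ} (hc : 0 < c) :
    ∃ c' : ℝ, 0 < c' ∧
      ∀ (q : ℕ) [NeZero q], 4 < q → ∀ χ : DirichletCharacter ℂ q,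
        χ.IsPrimitive → χ.IsQuadratic → χ.Odd →
          ‖χ.LFunction 1‖ < c' * Real.log q ^ (-(90 : ℝ)) →
            ∃ T : ℝ, 2001 ≤ T ∧ ((closeCriticalZeros T).ncard : ℝ) < c * T * Real.log T ^ ((4 : ℝ) / 5) := by
  obtain ⟨c', hc', h⟩ := hCI c hc
  refine ⟨c', hc', fun q _ hq χ hprim hquad hodd hsmall => ?_⟩
  by_contra hno
  push Not at hno
  have hyp : SubnormalGapsHypothesis c := fun T hT => hno T hT
  have := h hyp q hq χ hprim hquad hodd
  linarith

/-! ### The CI-GAPS door of record (cell ls-idea, coordinator 21-frontier 2026-08-27T18:09:13Z):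
pointer theorems (proved) -/

/-- **The CI-GAPS door (pointer).** Under Conrey–Iwaniec's Theorem 1.2, the ζ-gap hypothesis (1.22)
with ANY implied constant `c > 0` (`SubnormalGapsHypothesis c`, the door's X) yields the EFFECTIVE lower
bound `‖L(1,χ)‖ ≥ c′(log q)^{−90}` for every ODD real primitive character `χ` of conductor `q > 4`
(the door's Y, odd half; imaginary quadratic `K = ℚ(√−q)`). Even real characters are NOT covered by
the printed theorem. One-line unpacking of the named fact. [cite: ConreyIwaniec2002, Theorem 1.2] -/
theorem ciGaps_door (hCI : conreyIwaniec2002_theorem12) {c : ℝ} (hc : 0 < c)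
    (hX : SubnormalGapsHypothesis c) :
    ∃ c' : ℝ, 0 < c' ∧ ∀ (q : ℕ) [NeZero q], 4 < q → ∀ χ : DirichletCharacter ℂ q,
      χ.IsPrimitive → χ.IsQuadratic → χ.Odd →
        c' * Real.log q ^ (-(90 : ℝ)) ≤ ‖χ.LFunction 1‖ := by
  obtain ⟨c', hc', h⟩ := hCI c hc
  exact ⟨c', hc', h hX⟩

/-- **The CI-GAPS door, uniform form**: under Theorem 1.2, if (1.22) holds with SOME constant `c > 0`
then ONE effective constant `c′ > 0` serves all odd real primitive characters of conductor `> 4`.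
[cite: ConreyIwaniec2002, Theorem 1.2] -/
theorem ciGaps_door_exists (hCI : conreyIwaniec2002_theorem12)
    (hX : ∃ c : ℝ, 0 < c ∧ SubnormalGapsHypothesis c) :
    ∃ c' : ℝ, 0 < c' ∧ ∀ (q : ℕ) [NeZero q], 4 < q → ∀ χ : DirichletCharacter ℂ q,
      χ.IsPrimitive → χ.IsQuadratic → χ.Odd →
        c' * Real.log q ^ (-(90 : ℝ)) ≤ ‖χ.LFunction 1‖ := by
  obtain ⟨c, hc, hXc⟩ := hX
  exact ciGaps_door hCI hc hXc

end Literature.NumberTheory.LFunctions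

end
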